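import Literature.Combinatorics.SimpleGraph.CellChain
import Literature.Computability.Complexity.CountingReductions
import HarnessLib

/-!
# The grid graph of a formula, I: rows, columns, tiles and the chain of cells

Bookkeeping for the grid-native `#3SAT ≤ #HamPath` construction (Liśkiewicz–Ogihara–Toda 2003,
Lemma 4 / Theorem 7; tree fact `Literature.Barriers.CriticalPhenomena.GridSAW.LOT2003_lemma4_gadgets`).
For a CNF `ψ` over `ℕ` the **columns** are the literal occurrences `ψ.flatten` (numbered `0, …, N-1`,
clause by clause) and the **rows** are the distinct variables in order of first occurrence
(`varRows`, numbered `0, …, V-1`). The layout is a `V × N` matrix of **tiles** followed by a clause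
row: tile `(i, j)` is `empty` above the row of the variable of column `j`, `tap` on it (the column
wire starts there, reading the row wire) and `cross` below it (the row wire of variable `i` crosses
the column wire of column `j`). Every tile consists of three cells of the chain of `CellChain.lean`:
three one-bit cells for `empty`/`tap`, and the parity crossover `pc, pct, pc` for `cross`
(`GridCells.lean`); cell `0` is an unconstrained one-bit cell (it doubles the count, making the shift
of the r-shift reduction positive) and the last `N` cells are the one-bit terminals of the clause row.

* `cols`, `N`, `varRows`, `V`, `rowOf`, `varOf`, `polOf`;
* `TileTy`, `tileTy i j`; `ncells = 1 + 3 V N + N`, `tileCell i j c`, `clauseBead j`, `cellTyAt`,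
  **`cellsOf ψ : List CellTy`** (the chain) and the index arithmetic;
* the local slot edges used by the tiles (`Slot.*`) and that they are cell edges.

The gadgets (XOR-chords between slots, OR-gadgets at the clause row) and the count are in the sequel
files.

## References

* M. Liśkiewicz, M. Ogihara, S. Toda, TCS 304 (2003) 129–156, §3 (proof of Lemma 4).
* D. Lichtenstein, *Planar formulae and their uses*, SIAM J. Comput. 11 (1982) 329–343 (variable
  rows crossed by clause columns; here the crossings are crossover tiles, not a planarity hypothesis).
-/

namespace Literature.Combinatorics.SimpleGraph

namespace GridFormula

open GridCell GridCell.CellTy Literature.Computability.Complexity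

variable (ψ : CNF ℕ)

/-! ### Columns and rows -/

/-- **The columns**: the literal occurrences of `ψ`, clause by clause. [folklore] -/
def cols : List (Literal ℕ) := ψ.flatten

/-- The number of columns. [folklore] -/
def N : ℕ := (cols ψ).length

/-- Append a new element to a list of distinct elements. [folklore] -/
def insertNew (xs : List ℕ) (x : ℕ) : List ℕ := if x ∈ xs then xs else xs ++ [x]

/-- The distinct elements of a list, in order of first occurrence, appended to `acc`. [folklore] -/
def firstOccs (acc : List ℕ) : List ℕ → List ℕ
  | [] => acc
  | x :: l => firstOccs (insertNew acc x) l

/-- `firstOccs` keeps distinctness. [folklore] -/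
theorem firstOccs_nodup : ∀ {acc : List ℕ} (l : List ℕ), acc.Nodup → (firstOccs acc l).Nodup
  | _, [], h => h
  | acc, x :: l, h => by
    unfold firstOccs insertNew
    split_ifs with hx
    · exact firstOccs_nodup l h
    · exact firstOccs_nodup l (List.nodup_append.2 ⟨h, List.nodup_singleton x, by
        intro a ha b hb; rw [List.mem_singleton.1 hb]; rintro rfl; exact hx ha⟩)

/-- Membership in `firstOccs`. [folklore] -/
theorem mem_firstOccs_iff : ∀ {acc : List ℕ} (l : List ℕ) {y : ℕ}, y ∈ firstOccs acc l ↔ y ∈ acc ∨ y ∈ l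
  | _, [], _ => by simp [firstOccs]
  | acc, x :: l, y => by
    unfold firstOccs insertNew
    split_ifs with hx
    · rw [mem_firstOccs_iff l]
      constructor
      · rintro (h | h)
        exacts [Or.inl h, Or.inr (List.mem_cons_of_mem _ h)]
      · rintro (h | h)
        · exact Or.inl h
        · rcases List.mem_cons.1 h with rfl | h
          exacts [Or.inl hx, Or.inr h]
    · rw [mem_firstOccs_iff l, List.mem_append, List.mem_singleton, List.mem_cons]
      tauto

/-- **The rows**: the distinct variables of `ψ`, in order of first occurrence. [folklore] -/
def varRows : List ℕ := firstOccs [] ((cols ψ).map Prod.fst)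

/-- The rows are distinct variables. [folklore] -/
theorem varRows_nodup : (varRows ψ).Nodup := firstOccs_nodup _ List.nodup_nil

/-- A number is a row iff it is a variable of `ψ`. [folklore] -/
theorem mem_varRows_iff {x : ℕ} : x ∈ varRows ψ ↔ x ∈ ψ.vars := by
  rw [varRows, mem_firstOccs_iff, CNF.vars, List.mem_toFinset]
  simp [cols]

/-- The rows enumerate the variable set. [folklore] -/
theorem varRows_toFinset : (varRows ψ).toFinset = ψ.vars := by
  ext x; rw [List.mem_toFinset, mem_varRows_iff]

/-- The number of rows (= the number of variables). [folklore] -/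
def V : ℕ := (varRows ψ).length

/-- `V = |vars|`. [folklore] -/
theorem V_eq_card_vars : V ψ = ψ.vars.card := by
  rw [V, ← varRows_toFinset, List.toFinset_card_of_nodup (varRows_nodup ψ)]

/-- **The row of a variable** (its position among the rows; `V` if it does not occur). [folklore] -/
def rowOf (x : ℕ) : ℕ := (varRows ψ).idxOf x

/-- The row of an occurring variable is below `V`. [folklore] -/
theorem rowOf_lt {x : ℕ} (hx : x ∈ ψ.vars) : rowOf ψ x < V ψ :=
  List.idxOf_lt_length_of_mem ((mem_varRows_iff ψ).2 hx)

/-- The variable of row `i`. [folklore] -/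
theorem getElem_varRows_rowOf {x : ℕ} (hx : x ∈ ψ.vars) : (varRows ψ)[rowOf ψ x]'(rowOf_lt ψ hx) = x :=
  List.getElem_idxOf _

/-- `rowOf` inverts the enumeration of the rows. [folklore] -/
theorem rowOf_getElem {i : ℕ} (hi : i < V ψ) : rowOf ψ (varRows ψ)[i] = i :=
  (varRows_nodup ψ).idxOf_getElem i hi

/-- **The variable of column `j`.** [folklore] -/
def varOf (j : ℕ) : ℕ := ((cols ψ).getD j (0, true)).1

/-- **The polarity of column `j`** (`true` = a positive literal). [folklore] -/
def polOf (j : ℕ) : Bool := ((cols ψ).getD j (0, true)).2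

/-- The literal of column `j`. [folklore] -/
theorem cols_getElem {j : ℕ} (hj : j < N ψ) : (cols ψ)[j]'hj = (varOf ψ j, polOf ψ j) := by
  rw [varOf, polOf, List.getD_eq_getElem _ _ hj]

/-- The variable of a column occurs. [folklore] -/
theorem varOf_mem_vars {j : ℕ} (hj : j < N ψ) : varOf ψ j ∈ ψ.vars := by
  rw [CNF.vars, List.mem_toFinset, List.mem_map]
  exact ⟨(cols ψ)[j], List.getElem_mem hj, by rw [cols_getElem ψ hj]⟩

/-- The row of the variable of a column is below `V`. [folklore] -/
theorem rowOf_varOf_lt {j : ℕ} (hj : j < N ψ) : rowOf ψ (varOf ψ j) < V ψ :=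
  rowOf_lt ψ (varOf_mem_vars ψ hj)

/-- If there is a column then there is a row. [folklore] -/
theorem V_pos_of_N_pos (h : 0 < N ψ) : 0 < V ψ :=
  lt_of_le_of_lt (Nat.zero_le _) (rowOf_varOf_lt ψ h)

/-! ### Tiles -/

/-- The three tile types. [folklore] -/
inductive TileTy
  | empty
  | tap
  | cross
  deriving DecidableEq, Repr

/-- **The type of tile `(i, j)`**: `empty` above the row of the variable of column `j`, `tap` on it,
`cross` below it. [folklore] -/
def tileTy (i j : ℕ) : TileTy :=
  if i < rowOf ψ (varOf ψ j) then .empty else if i = rowOf ψ (varOf ψ j) then .tap else .cross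

/-- The tile is a crossing iff the row is below the variable's row. [folklore] -/
theorem tileTy_eq_cross_iff {i j : ℕ} : tileTy ψ i j = .cross ↔ rowOf ψ (varOf ψ j) < i := by
  unfold tileTy; split_ifs <;> simp <;> omega

/-- The tile is a tap iff the row is the variable's row. [folklore] -/
theorem tileTy_eq_tap_iff {i j : ℕ} : tileTy ψ i j = .tap ↔ i = rowOf ψ (varOf ψ j) := by
  unfold tileTy; split_ifs <;> simp <;> omega

/-- The tile is empty iff the row is above the variable's row. [folklore] -/
theorem tileTy_eq_empty_iff {i j : ℕ} : tileTy ψ i j = .empty ↔ i < rowOf ψ (varOf ψ j) := by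
  unfold tileTy; split_ifs <;> simp <;> omega

/-! ### Cells -/

/-- **The number of cells**: the doubling cell, three cells per tile, one terminal per column.
[folklore] -/
def ncells : ℕ := 1 + 3 * (V ψ * N ψ) + N ψ

/-- The index of cell `c ∈ {0,1,2}` of tile `(i, j)`. [folklore] -/
def tileCell (i j c : ℕ) : ℕ := 1 + 3 * (i * N ψ + j) + c

/-- The index of the clause-row terminal of column `j`. [folklore] -/
def clauseBead (j : ℕ) : ℕ := 1 + 3 * (V ψ * N ψ) + j

/-- **The type of cell `k`.** [folklore] -/
def cellTyAt (k : ℕ) : CellTy :=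
  if k = 0 then .bead
  else if k < 1 + 3 * (V ψ * N ψ) then
    (if tileTy ψ ((k - 1) / 3 / N ψ) ((k - 1) / 3 % N ψ) = .cross then
      (if (k - 1) % 3 = 0 then .pc else if (k - 1) % 3 = 1 then .pct else .pc)
    else .bead)
  else .bead

/-- **The chain of cells of `ψ`.** [folklore] -/
def cellsOf : List CellTy := (List.range (ncells ψ)).map (cellTyAt ψ)

/-- The chain has `ncells` cells. [folklore] -/
@[simp] theorem length_cellsOf : (cellsOf ψ).length = ncells ψ := by simp [cellsOf]

/-- The chain is nonempty. [folklore] -/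
theorem cellsOf_ne_nil : cellsOf ψ ≠ [] := by
  apply List.ne_nil_of_length_pos; rw [length_cellsOf]; unfold ncells; omega

/-- The cell types of the chain. [folklore] -/
theorem cellTy_cellsOf {k : ℕ} (hk : k < ncells ψ) : cellTy (cellsOf ψ) k = cellTyAt ψ k := by
  rw [cellTy_eq_getElem (by rwa [length_cellsOf])]
  simp [cellsOf]

/-- Index arithmetic of tile cells. [folklore] -/
theorem tileCell_arith {i j c : ℕ} (hj : j < N ψ) (hc : c < 3) :
    (tileCell ψ i j c - 1) / 3 / N ψ = i ∧ (tileCell ψ i j c - 1) / 3 % N ψ = j ∧ (tileCell ψ i j c - 1) % 3 = c := by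
  have hN : 0 < N ψ := by omega
  have h1 : (tileCell ψ i j c - 1) / 3 = i * N ψ + j := by unfold tileCell; omega
  refine ⟨?_, ?_, by unfold tileCell; omega⟩
  · rw [h1, Nat.add_div hN, Nat.mul_div_cancel _ hN, Nat.div_eq_of_lt hj]
    simp [Nat.mod_eq_of_lt hj, show ¬ N ψ ≤ j from not_le.2 hj]
  · rw [h1, Nat.add_mod, Nat.mul_mod_left, zero_add, Nat.mod_mod, Nat.mod_eq_of_lt hj]

/-- Tile cells are below the clause row. [folklore] -/
theorem tileCell_lt {i j c : ℕ} (hi : i < V ψ) (hj : j < N ψ) (hc : c < 3) : tileCell ψ i j c < 1 + 3 * (V ψ * N ψ) := by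
  unfold tileCell
  have : i * N ψ + j < V ψ * N ψ := by
    calc i * N ψ + j < i * N ψ + N ψ := by omega
      _ = (i + 1) * N ψ := by ring
      _ ≤ V ψ * N ψ := Nat.mul_le_mul_right _ hi
  omega

/-- Tile cells are cells. [folklore] -/
theorem tileCell_lt_ncells {i j c : ℕ} (hi : i < V ψ) (hj : j < N ψ) (hc : c < 3) : tileCell ψ i j c < ncells ψ :=
  lt_of_lt_of_le (tileCell_lt ψ hi hj hc) (by unfold ncells; omega)

/-- Tile cells are not the doubling cell. [folklore] -/
theorem tileCell_pos (i j c : ℕ) : 0 < tileCell ψ i j c := by unfold tileCell; omega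

/-- **The type of a tile cell.** [folklore] -/
theorem cellTyAt_tileCell {i j c : ℕ} (hi : i < V ψ) (hj : j < N ψ) (hc : c < 3) :
    cellTyAt ψ (tileCell ψ i j c) =
      if tileTy ψ i j = .cross then (if c = 0 then .pc else if c = 1 then .pct else .pc) else .bead := by
  obtain ⟨h1, h2, h3⟩ := tileCell_arith ψ (i := i) hj hc
  unfold cellTyAt
  rw [if_neg (tileCell_pos ψ i j c).ne', if_pos (tileCell_lt ψ hi hj hc), h1, h2, h3]

/-- Clause-row terminals are cells. [folklore] -/
theorem clauseBead_lt_ncells {j : ℕ} (hj : j < N ψ) : clauseBead ψ j < ncells ψ := by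
  unfold clauseBead ncells; omega

/-- **Clause-row terminals are one-bit cells.** [folklore] -/
theorem cellTyAt_clauseBead (j : ℕ) : cellTyAt ψ (clauseBead ψ j) = .bead := by
  unfold cellTyAt clauseBead
  rw [if_neg (by omega), if_neg (by omega)]

/-- **The doubling cell is a one-bit cell.** [folklore] -/
theorem cellTyAt_zero : cellTyAt ψ 0 = .bead := by simp [cellTyAt]

/-- `tileCell` is injective. [folklore] -/
theorem tileCell_inj {i j c i' j' c' : ℕ} (hj : j < N ψ) (hc : c < 3) (hj' : j' < N ψ) (hc' : c' < 3)
    (h : tileCell ψ i j c = tileCell ψ i' j' c') : i = i' ∧ j = j' ∧ c = c' := by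
  obtain ⟨h1, h2, h3⟩ := tileCell_arith ψ (i := i) hj hc
  obtain ⟨h1', h2', h3'⟩ := tileCell_arith ψ (i := i') hj' hc'
  rw [h] at h1 h2 h3
  exact ⟨h1.symm.trans h1', h2.symm.trans h2', h3.symm.trans h3'⟩

/-- Tile cells are not clause-row terminals. [folklore] -/
theorem tileCell_ne_clauseBead {i j c : ℕ} (hi : i < V ψ) (hj : j < N ψ) (hc : c < 3) (j' : ℕ) :
    tileCell ψ i j c ≠ clauseBead ψ j' := by
  have := tileCell_lt ψ hi hj hc; unfold clauseBead; omega

/-- `clauseBead` is injective. [folklore] -/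
theorem clauseBead_inj {j j' : ℕ} : clauseBead ψ j = clauseBead ψ j' ↔ j = j' := by unfold clauseBead; omega

/-! ### The local slot edges of the tiles -/

namespace Slot

/-- One-bit cell, side opposite to the bottom: the west edge `(0,0)–(0,1)` (¬bit). [folklore] -/
def bN0 : Fin 16 × Fin 16 := (0, 4)
/-- One-bit cell: the top edge `(1,2)–(2,2)` (bit); row wires enter here. [folklore] -/
def bN3 : Fin 16 × Fin 16 := (9, 10)
/-- One-bit cell: the east edge `(3,0)–(3,1)` (¬bit); row wires leave here. [folklore] -/
def bN6 : Fin 16 × Fin 16 := (3, 7)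
/-- One-bit cell, bottom side: `(0,0)–(1,0)` (bit); the OR-gadgets of the clause row attach here. [folklore] -/
def bS0 : Fin 16 × Fin 16 := (0, 1)
/-- One-bit cell, bottom side: `(1,0)–(2,0)` (¬bit); column wires leave a tap here. [folklore] -/
def bS1 : Fin 16 × Fin 16 := (1, 2)
/-- Parity cell `pc`: west edge `(0,0)–(0,1)` (`¬a`); row wires enter a crossing here. [folklore] -/
def pN0 : Fin 16 × Fin 16 := (0, 4)
/-- Parity cell `pc`: top edge `(1,3)–(2,3)` (`a XOR b`); column wires enter a crossing here. [folklore] -/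
def pN4 : Fin 16 × Fin 16 := (13, 14)
/-- Parity cell `pc`: east edge `(3,0)–(3,1)` (`¬b`). [folklore] -/
def pN8 : Fin 16 × Fin 16 := (3, 7)
/-- Parity cell `pc`: bottom west `(0,0)–(1,0)` (`a`). [folklore] -/
def pS0 : Fin 16 × Fin 16 := (0, 1)
/-- Parity cell `pc`: bottom east `(2,0)–(3,0)` (`b`). [folklore] -/
def pS2 : Fin 16 × Fin 16 := (2, 3)
/-- Reflected parity cell `pct`: top east `(2,3)–(3,3)` (`¬b`). [folklore] -/
def tN2 : Fin 16 × Fin 16 := (14, 15)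
/-- Reflected parity cell `pct`: west edge `(0,2)–(0,3)` (`a`). [folklore] -/
def tS0 : Fin 16 × Fin 16 := (8, 12)
/-- Reflected parity cell `pct`: bottom `(1,0)–(2,0)` (`a XOR b`). [folklore] -/
def tS4 : Fin 16 × Fin 16 := (1, 2)
/-- Reflected parity cell `pct`: east edge `(3,2)–(3,3)` (`b`); column wires leave a crossing here. [folklore] -/
def tS8 : Fin 16 × Fin 16 := (11, 15)

/-- The slot edges are cell edges of their cell types. [folklore] -/
theorem adjB_slots :
    bead.adjB bN0.1 bN0.2 = true ∧ bead.adjB bN3.1 bN3.2 = true ∧ bead.adjB bN6.1 bN6.2 = true ∧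
    bead.adjB bS0.1 bS0.2 = true ∧ bead.adjB bS1.1 bS1.2 = true ∧
    pc.adjB pN0.1 pN0.2 = true ∧ pc.adjB pN4.1 pN4.2 = true ∧ pc.adjB pN8.1 pN8.2 = true ∧
    pc.adjB pS0.1 pS0.2 = true ∧ pc.adjB pS2.1 pS2.2 = true ∧
    pct.adjB tN2.1 tN2.2 = true ∧ pct.adjB tS0.1 tS0.2 = true ∧ pct.adjB tS4.1 tS4.2 = true ∧
    pct.adjB tS8.1 tS8.2 = true := by
  decide

end Slot

/-- **A global slot**: the local edge `e` of cell `k`. [folklore] -/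
def gs (k : ℕ) (e : Fin 16 × Fin 16) : ℕ × ℕ := (vtx k e.1, vtx k e.2)

/-- The cell of a global slot. [folklore] -/
theorem gs_fst_div (k : ℕ) (e : Fin 16 × Fin 16) : (gs k e).1 / 17 = k ∧ (gs k e).2 / 17 = k :=
  ⟨vtx_div _ _, vtx_div _ _⟩

/-- `gs` is injective. [folklore] -/
theorem gs_inj {k k' : ℕ} {e e' : Fin 16 × Fin 16} : gs k e = gs k' e' ↔ k = k' ∧ e = e' := by
  simp only [gs, Prod.mk.injEq, vtx_inj]
  constructor
  · rintro ⟨⟨rfl, h1⟩, ⟨-, h2⟩⟩; exact ⟨rfl, Prod.ext h1 h2⟩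
  · rintro ⟨rfl, rfl⟩; exact ⟨⟨rfl, rfl⟩, ⟨rfl, rfl⟩⟩

/-- A global slot of a cell of matching type is a chain edge. [folklore] -/
theorem gs_adj {ts : List CellTy} {k : ℕ} (hk : k < ts.length) {e : Fin 16 × Fin 16}
    (he : (cellTy ts k).adjB e.1 e.2 = true) : (GridCell.chainG ts).Adj (gs k e).1 (gs k e).2 :=
  adj_vtx_vtx hk he

end GridFormula

end Literature.Combinatorics.SimpleGraph
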